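import Literature.AlgebraicGeometry.Motives.AbelianVariety
import Literature.AlgebraicGeometry.Motives.BaseChange
import Literature.AlgebraicGeometry.LaurentSchroer2023.ParaAbelianGroupLaw
import HarnessLib

/-!
# A para-abelian variety with a rational point is an abelian variety (Laurent–Schröer, §4, Prop. 4.3, field case)

Topic `Literature/AlgebraicGeometry/Motives` (family `hodge`). ONE NAMED FACT (D-0014: a `def … : Prop`, taken as a
hypothesis BY NAME, never asserted), on the real carriers of `Motives/AbelianVariety.lean` (`AbelianVariety`),
`Motives/BaseChange.lean` (`baseChangeHom`, base change of `k`-schemes along a ring homomorphism `σ : k →+* K`) and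
`Motives/AlgPoints.lean` (`AlgPoints P k`, the `k`-rational points of a `k`-scheme):

* `laurentSchroer_abelianVariety_of_paraAbelian_of_ratPoint` — for a homomorphism of fields `σ : k →+* K`, a
  `k`-scheme `P` whose base change `P ⊗_{k,σ} K` is `K`-isomorphic to the underlying scheme of an abelian variety over
  `K` (i.e. `P` is PARA-ABELIAN), and a rational point `e ∈ P(k)`: `P` itself is the underlying `k`-scheme of an
  abelian variety over `k`.

COUNT ONCE (revision 2 of this file). The cell's CANONICAL Lean statement of this print fact is the literature
seat's `Literature.AlgebraicGeometry.LaurentSchroer2023.groupLaw_of_isParaAbelian_of_point` (file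
`LaurentSchroer2023/ParaAbelianGroupLaw.lean`, landed seven minutes before revision 1 of this file, with the zero
section identified: a STRONGER typing of the same Prop. 4.3). The `def` below is the section-free existence shape of
the same statement and is DERIVED from the canonical one in the kernel
(`laurentSchroer_abelianVariety_of_paraAbelian_of_ratPoint_of_groupLaw`, proved below: para-abelian along `σ` is
`IsParaAbelian` for the `k`-algebra structure `σ` on `K`). It is therefore NOT an independent hypothesis of anything:
consumers bind the canonical fact (the consumer named below does, from its revision 2 on); this file is kept as the
record of the equivalence of the two typings and may be retired by the operator.

Source (held and read: lit `paper:arxiv-2101.10829`, p. 12–13 of the arXiv text). B. Laurent, S. Schröer,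
*Para-abelian varieties and Albanese maps*, Bull. Braz. Math. Soc. (N.S.) 55 (2023), no. 1, doi:10.1007/s00574-023-00378-0 (arXiv
2101.10829), §4
"Para-abelian varieties": **Definition** (first paragraph of §4): *"Let us call an algebraic space `P` over some field `k`
a para-abelian variety if there is a field extension `k ⊂ k'` such that the base-change `P' = P ⊗_k k'` admits the
structure of an abelian variety."* (loc. cit.: *"By fpqc descent, our `P` is proper and smooth over `k`, with
`h⁰(𝒪_P) = 1`"*; Lemma 4.1: *"The algebraic space `P` is a projective scheme."*) **Proposition 4.3** (for a family of
para-abelian varieties `P → S`, Def. 4.2): *"For each `e ∈ P(S)`, there is a unique group law `μ : P ×_S P → P` that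
turns `P → S` into a family of abelian varieties, with `e : S → P` as the zero section."* — whose proof settles the
case of a field first: *"Note that this settles the assertion if `R = k` is a field."* A family of abelian varieties
over `S = Spec k` is an abelian variety over `k` (loc. cit., after Def. 4.2: *"a proper flat morphism of finite
presentation `A → S` endowed with a group structure, such that all fibers are abelian varieties"*), i.e. a proper,
geometrically integral `k`-group scheme — the tree's `Motives.AbelianVariety k` (Mumford, *Abelian Varieties*, §4;
Stacks 0BF9; smoothness and commutativity follow, Stacks 047N/0BFD). The printed theorem generalises Mumford–Fogarty–
Kirwan, *Geometric Invariant Theory*, Ch. 6 §3 Thm. 6.14 (loc. cit.: *"which generalize [Mumford; Fogarty; Kirwan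
1993], Theorem 6.14"*).

Dictionary onto the carriers. "field extension `k ⊂ k'`" ↦ a ring homomorphism of fields `σ : k →+* K` (injective)
and base change `P ⊗_{k,σ} K = (baseChangeHom σ).obj P` (`Motives/BaseChange.lean`, Hartshorne II.3); "`P'` admits the
structure of an abelian variety" ↦ `Nonempty (B.X ≅ (baseChangeHom σ).obj P)` for some `B : AbelianVariety K` (a group
structure transports along a `K`-isomorphism); "`e ∈ P(k)`" ↦ `Nonempty (AlgPoints P k)`; "admits a group law that turns
`P → Spec k` into a family of abelian varieties" ↦ `∃ A : AbelianVariety k, A.X = P`. A `k`-scheme is an algebraic space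
over `k`; no finiteness hypothesis on `P` is needed (properness and smoothness DESCEND, loc. cit.).

Deliberately NOT here: the relative statement over a general base `S` (the tree's
`raynaud1970_abelianScheme_section_projective`, `Motives/AbelianSchemeProjective.lean`, records its projectivity
consequence), the UNIQUENESS of the group law and the identification of its zero section with `e`, and Lemma 4.1
(projectivity) — the consumer (`Summits/HodgeConjecture`, route `deform`, part XVI-c's residual `QbarFibreDescent`:
an abelian complex fibre over a `ℚ̄`-point of a `ℚ̄`-family descends to `ℚ̄`) needs exactly the existence statement
below, with `k = ℚ̄` algebraically closed (so that the rational point exists by the Nullstellensatz). No junk values: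
all data are hypotheses; the conclusion is an `∃` over `AbelianVariety k` with an equality of `k`-schemes.
-/

noncomputable section

open CategoryTheory AlgebraicGeometry

namespace Literature.AlgebraicGeometry.Motives

universe u

/-- **A para-abelian variety with a rational point is an abelian variety** (Laurent–Schröer, *Para-abelian varieties
and Albanese maps*, §4: *"Let us call an algebraic space `P` over some field `k` a para-abelian variety if there is a
field extension `k ⊂ k'` such that the base-change `P' = P ⊗_k k'` admits the structure of an abelian variety"*;
Prop. 4.3: *"For each `e ∈ P(S)`, there is a unique group law `μ : P ×_S P → P` that turns `P → S` into a family of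
abelian varieties, with `e : S → P` as the zero section"*, case `S = Spec k`: *"Note that this settles the assertion
if `R = k` is a field"*). On the tree's carriers: for a homomorphism of fields `σ : k →+* K`, a `k`-scheme `P` with
`B.X ≅ P ⊗_{k,σ} K` over `K` for some abelian variety `B` over `K`, and a rational point of `P`, there is an abelian
variety `A` over `k` whose underlying `k`-scheme is `P`. Dictionary in the module docstring (field extension ↦ `σ` and
`baseChangeHom σ` [Hartshorne1977, Ch. II §3, "base extension"]; abelian variety ↦ `Motives.AbelianVariety`
[MumfordAV1970, §4]). Generalises [MumfordGIT, Ch. 6 §3 Thm. 6.14] (one abelian geometric fibre + a section ⟹ abelian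
scheme). Existence only; uniqueness of the group law and "zero section `= e`" are not recorded.
[cite: LaurentSchroer2023, §4 (definition of para-abelian variety, first paragraph) and Prop. 4.3 with its proof ("this settles the assertion if R = k is a field") (arXiv 2101.10829 pp. 12–13)]
[cite: MumfordGIT, Ch. 6 §3 Thm. 6.14] [cite: Hartshorne1977, Ch. II §3 (base extension)] [cite: MumfordAV1970, §4 (definition of abelian variety)] -/
def laurentSchroer_abelianVariety_of_paraAbelian_of_ratPoint : Prop :=
  ∀ ⦃k K : Type u⦄ [Field k] [Field K] (σ : k →+* K) (P : SchemeOver k) (B : AbelianVariety K),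
    Nonempty (B.X ≅ (baseChangeHom σ).obj P) → Nonempty (AlgPoints P k) →
    ∃ A : AbelianVariety k, A.X = P

/-- **Count once: the section-free shape follows from the canonical typing.** If Laurent–Schröer's Prop. 4.3 holds
in the literature seat's form `LaurentSchroer2023.groupLaw_of_isParaAbelian_of_point k` for every field `k` (an
abelian-variety structure on a para-abelian `P` with any prescribed rational point as zero), then the statement of
this file holds: a `K`-isomorphism `B.X ≅ P ⊗_{k,σ} K` makes `P` para-abelian (`IsParaAbelian.of_iso` for the
`k`-algebra structure `σ` on `K`), and the rational point serves as the zero. [cite: LaurentSchroer2023, §4 (definition of para-abelian variety) and Prop. 4.3 (case S = Spec k)] -/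
theorem laurentSchroer_abelianVariety_of_paraAbelian_of_ratPoint_of_groupLaw
    (h : ∀ (k : Type u) [Field k], LaurentSchroer2023.groupLaw_of_isParaAbelian_of_point k) :
    laurentSchroer_abelianVariety_of_paraAbelian_of_ratPoint.{u} := by
  intro k K _ _ σ P B hB hP
  obtain ⟨e⟩ := hB
  obtain ⟨p⟩ := hP
  letI : Algebra k K := σ.toAlgebra
  obtain ⟨A, hA, -⟩ := h k (LaurentSchroer2023.IsParaAbelian.of_iso (L := K) B e) p
  exact ⟨A, hA⟩

end Literature.AlgebraicGeometry.Motives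

end
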